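import Literature.MathematicalPhysics.QuantumFieldTheory.Balaban1983to89.B16MergeGeometry

/-!
# `Balaban1983to89.B16Absorption` — [Balaban1989LargeFieldII] p. 387, ll. 12–15: the ABSORPTION sentence of the merge
step («we obtain the domain S^{K₁+n₁}(Y) containing S^{K₁+n₁}(X)», `n₁ < 10`) TESTED in the ℤᵈ index model of the
operation `S` — an `L`-ADIC LADDER along which absorption fails for any prescribed number of consecutive iterates
(cell `STEP.md` §11 row O-F4, residual binder `hsub`; `GAPS.md` rows G-b02g10-1 / C-b02g10-1; `DIVERGENCE.md` D-b02g10.1;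
unit b2b-balaban-b02, gen 10 — NEW leaf module, imports `…B16MergeGeometry` and modifies nothing; v1.2 = v1 (p182230) with
one docstring made precise: the weight of (1.80) is `O(1)M^dR_n^{d+1}` at the running scale `n`, (1.88) prints `R^{d+1}_{j+1}`;
v2 = v1.2 (p182313) with Part 5 APPENDED — the positive ONE-LAYER absorption theorem — Parts 1–4 byte-unchanged;
v2.1 = v2 with Parts 5b–5c APPENDED — localisation of the iterates of X, the per-scale OVERHANG cube count, and the delay
under the drop control of the flow, uniform over all admissible flow patterns)

CITATION HEADER (lean-in-tree rule 2026-08-18).  Source under audit: T. Bałaban, *Large field renormalization. II.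
Localization, exponentiation, and bounds for the 𝐑 operation*, Commun. Math. Phys. **122**, 355–392 (1989)
[Balaban1989LargeFieldII] (cell paper B16; held `paper:balaban1989-cmp122-large-field-ii`, journal page = PDF page
+ 354).  The passage below was READ AS AN IMAGE by the typist on the x2 render
`b2b-balaban-ref1/pages/1989-cmp122-large-field-II/1989-cmp122-large-field-II-p033-x2.png` (p. 387 [PDF 33]); the
definition of `S` on `…-p030-x2.png` (p. 384 [PDF 30]) is the one typed by `…B16SProfile` (unit b02 gen 9, quoted
verbatim in that module's header: *"we take the cover Z′ of Z by a smallest union of LMR_{j+1}-cubes, and we add ten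
layers of such cubes … S(Z) = Z′^{~10}"*).  The paper is a manuscript UNDER ADJUDICATION by the audit cell
`pub-balaban`: NOTHING printed in it is asserted here; every `theorem` below is finite combinatorics on `ℤᵈ` and real
arithmetic, proved without `sorry` and without new axioms, over the EXISTING definitions
`B13ScaleTransfer.{Pt, Adj, block, collar, coarse, closureIdx}`, `B16SProfile.{box, Sop, Siter, ratio, qexp, DropCtl}`,
`B16MergeGeometry.Touch`, using BY NAME `B16SProfile.{mem_box, iterate_collar_box_subset, iterate_collar_mono,
iterate_collar_biUnion, mem_collar, Sop_mono, Siter_eq_biUnion}`, `B16MergeGeometry.{Siter_union, Touch.of_adj}`,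
`B13ScaleTransfer.{mem_block, adj_update_sub_one}`.

THE PRINTED TEXT.  B16 p. 387 [PDF 33], ll. 2–16 (the merge case of the inductive proof of (1.80), continuing (1.87)):
*"Consider the sum on the right-hand side of (1.80), with j + 1 instead of j. The domains X, Y intersect, or at least
touch each other, hence the intersection of S^{n−j−1}(X), S^{n−j−1}(Y), for n > j + 1, contains at least a cube of the
size 20MR_n. This implies that  d′_n(S^{n−j−1}(Z)) ≦ d′_n(S^{n−j−1}(X)) + d′_n(S^{n−j−1}(Y)).  The domains X, Y determine
the corresponding indices K₁, K₂. Now the situation is symmetric in X, Y, so we may assume that, for example K₁ ≦ K₂. The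
domain S^{K₁}(X) satisfies the conditions (i), (ii), in particular it is contained in a cube of the size 100MR_{j+1+K₁},
and it intersects the domains S^{K₁}(Y). It is clear that applying n₁ times the operation S to the last domain, where n₁
is a rather small number, e.g., n₁ < 10, we obtain the domain S^{K₁+n₁}(Y) containing S^{K₁+n₁}(X). This implies that
S^{n−j−1}(Z) = S^{n−j−1}(Y) for n ≧ j + 1 + K₁ + n₁, and that K ≦ K₂ + n₁ + R_{j+1}. To prove the statement for κ_{j+1}(Z)
we estimate the sum in (1.80):  Σ_{n=j+2}^{j+1+K} O(1)M^dR^{d+1}_{j+1}d′_n(S^{n−j−1}(Z))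
≦ Σ_{n=j+2}^{j+1+K₁+n₁} O(1)M^dR^{d+1}_{j+1}d′_n(S^{n−j−1}(X)) + Σ_{n=j+2}^{j+1+K₂+n₁+R_{j+1}} O(1)M^dR^{d+1}_{j+1}d′_n(S^{n−j−1}(Y))
≦ κ_{j+1}(X) + κ_{j+1}(Y) + O(1)2(100M)^dR^{d+2}_{j+1} ≦ κ_{j+1}(Z) − 2(1 + β₀)^{−1}p₀(g_{j+1}) + O(1)3(100M)^dR^{d+2}_{j+1}
≦ κ_{j+1}(Z),  (1.88)  for p₀ large and γ small enough. This completes the inductive proof of the statement."*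

READING (declared, not printed — identical to `…B16SProfile`'s).  The partitions into `MR_n`-cubes at the successive
scales are NESTED and indexed by `Pt d = ℤᵈ`; passing to the next partition is `coarse q = ⌊·/q⌋` coordinatewise with
`q = LR_{n+1}/R_n` a power of `L`; *"the cover Z′ of Z by a smallest union of LMR_{j+1}-cubes"* is `closureIdx q Z`,
*"ten layers of such cubes"* is `collar^[10]`, `S = Sop q = collar^[10] ∘ closureIdx q`, and `S^{m}` along the ratio
sequence `q₀, q₁, …` is `Siter q m`.  Below the ratio sequence is the CONSTANT one, `fun _ => L` = `ratio L (fun _ => s)`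
(`ratio_const`): the flow pattern `R_n = L^s` for all `n`, which obeys the drop control `DropCtl` of `…B16SProfile`
(`dropCtl_const`) and the first member of (2.9) [III] with equality — i.e. an ADMISSIBLE flow pattern for every module of
the cell that consumes one (`B16SProfile.majorant_181_of_flow`, `B16StoppingRule.find_stopAt_le`); print's `L` is any
integer `≥ 2`, the theorems ask `1 ≤ L` only.

WHAT IS PROVED (unconditionally; every dimension `d`, every coordinate direction `i : Fin d`, every `L ≥ 1`, every `n`).
* Part 1 (coordinate envelopes of ONE `S`-step, arbitrary ratio `q ≥ 1`): if every cube of `T` has `i`-th index `≤ H`,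
  every cube of `S_q(T)` has `i`-th index `≤ ⌊H/q⌋ + 10` (`coord_le_of_mem_Sop`); and for `z ∈ T` the cube
  `⌊z/q⌋ + 10·𝟙` (all indices shifted by ten) belongs to `S_q(T)` (`shift_coarse_mem_Sop`, via `box c n ⊆ collar^[n]{c}`,
  `box_subset_iterate_collar`).  Iterated: along `S^{m}` the sup of the `i`-th index of `S^{m}(Y)` is `≤ env q H m` and
  the value `env q (z i) m` is ATTAINED in `S^{m}({z})`, where `env q H 0 = H`, `env q H (m+1) = ⌊env q H m / q_m⌋ + 10`
  (`coord_le_env`, `exists_mem_Siter_coord_eq`).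
* Part 2 (the `L`-adic ladder): `ladder L 0 = 20L`, `ladder L (k+1) = L·(ladder L k − 10)`; one coarsening by `L` sends
  the pair `(ladder L (k+1) − 1, ladder L (k+1))` to `(ladder L k − 11, ladder L k − 10)` and `(20L − 1, 20L)` to
  `(19, 20)` (`ladder_succ_ediv`, `ladder_succ_sub_one_ediv`, `ladder_zero_ediv`, `ladder_zero_sub_one_ediv`), whence
  along the constant ratio `L`:  `env (ladder L n) m = env (ladder L n − 1) m + 1` for EVERY `m ≤ n + 1`
  (`env_ladder_gap`) — the two orbits of `u ↦ ⌊u/L⌋ + 10` started one apart at the foot of the ladder stay one apart for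
  `n + 1` steps.
* Part 3 (NON-ABSORPTION PERSISTS): let `x ∈ ℤᵈ` have `x i = ladder L n` and let `Y ⊆ ℤᵈ` be ANY finite set of cubes in
  the half-space `{y | y i ≤ x i − 1}` (for instance `Y ∋ x − e_i`, the cube having a common WALL with `x`, so that
  `X = {x}` and `Y` *"intersect, or at least touch each other"*, and `Y` as large as one pleases).  Then for EVERY
  `m ≤ n + 1` the iterate `S^{m}({x})` has a cube whose `i`-th index exceeds that of every cube of `S^{m}(Y)`
  (`exists_protruding`); hence `S^{m}({x}) ⊄ S^{m}(Y)` (`not_subset_of_ladder`), `S^{m}({x} ∪ Y) ≠ S^{m}(Y)`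
  (`Siter_union_ne_of_ladder`) and `|S^{m}(Y)| < |S^{m}({x} ∪ Y)|` (`card_lt_of_ladder`).  Packaged as the negation of
  the printed sentence read UNIFORMLY in the model (`no_uniform_absorption`): for every `L ≥ 1`, every direction `i` and
  every `n₁` there are a ONE-CUBE domain `X = {x}` (contained in a cube of any size `≥ MR`; it satisfies (i) at every
  scale) and a domain `Y ∋ x − e_i` with a common wall with it, such that `S^{m}(Y) ⊉ S^{m}(X)` for ALL `m ≤ n₁ + 1` — in
  particular, taking `n₁ := K₁ + n₁'`, for all `m = K₁, …, K₁ + n₁'` whatever `K₁` is.  (`x − e_i` may be replaced by any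
  `Y` behind the wall: `halfspace_insert`.)
* Part 4 (the cube-count defect this feeds into (1.88)): for non-negative weights `w_m` and every horizon `K ≥ n + 1`,
  `Σ_{m=1}^{K} w_m |S^{m}(Y)| + Σ_{m=1}^{n+1} w_m ≤ Σ_{m=1}^{K} w_m |S^{m}({x} ∪ Y)|` (`sum_card_defect`): in the
  cube-count currency (the one p. 384's own chain *"d′_n(S^{n−j}(Z)) ≦ (63)^d(MR_n)^{−d}|Z^{(n−j)}| ≦ …"* passes
  through) the terms of (1.80)'s sum for `Z = X ∪ Y` exceed those for `Y` by at least the full weight at each of the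
  first `n + 1` scales, `n` at the typist's disposal — whereas the printed chain (1.88) replaces them by the `Y`-terms from
  the scale `K₁ + n₁` on (`n₁ < 10`) and budgets a UNIFORM `O(1)2(100M)^dR^{d+2}_{j+1}` for the rest.
* Part 5 (v2 — WHAT SURVIVES: ONE-LAYER ABSORPTION WITH A UNIFORM DELAY, for an ARBITRARY ratio sequence `q_l ≥ 1`):
  the iterates of one cube are product boxes — `S^{m}({z})` is caught between `pbox (envLo (z ·) m) (env (z ·) m)` from
  above and, for `z ∈ T`, that box lies in `S^{m}(T)` (`Siter_singleton_subset_pbox`, `pbox_orbit_subset_Siter`; one step: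
  `Sop_pbox_subset`, `pbox_subset_Sop`, the latter by surjectivity of coarsening on intervals, `exists_preimage_ediv`);
  the ends contract — `a ≤ b + D ⇒ env a m ≤ env b m + shrink D m`, `b − D ≤ a ⇒ envLo b m − shrink D m ≤ envLo a m`,
  where `shrink q D m` is the orbit of `D` under the CEILING divisions `D ↦ ⌈D/q_l⌉` (`cdiv`; `env_le_env_add_shrink`,
  `envLo_sub_shrink_le`) and `shrink D m ≤ ⌈D/2^{g}⌉` after `g = gains q m` steps with `q_l ≥ 2` (`shrink_le_cdiv_pow`).
  Hence (`one_layer_absorption`): if every cube of `X` is within sup-distance `D` of a cube `c ∈ T` then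
  `S^{m}(X) ⊆ (S^{m}(T))^{~1}` — ONE layer of cubes — whenever `shrink q D m ≤ 1`, in particular whenever
  `D ≤ 2^{gains q m}` (`one_layer_absorption_of_gains`; along the constant ratio `L ≥ 2`: whenever `D ≤ 2^m`,
  `one_layer_absorption_const`).  In the printed situation `D ≤ 101` (condition (i): *"contained in a cube of the size
  100MR"*, and touching), so SEVEN gaining steps suffice — uniformly in `X`, `Y`, the position and the scale — on the very
  flow where CONTAINMENT (zero layers) fails for every prescribed number of steps (Part 3).  Reader-level consequence
  (cell `GAPS.md` G-b02g10-1 (3b), C-b02g10-2): the horizon half of the sentence, *"K ≦ K₂ + n₁ + R_{j+1}"*, survives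
  with a uniform `n₁`; the cost identity *"S^{n−j−1}(Z) = S^{n−j−1}(Y)"* and the first `≦` of (1.88) do not.
* Part 5b (v2.1 — LOCALISATION AND THE PER-SCALE OVERHANG COUNT): `S^{m}(X) ⊆ pbox (envLo (c ·) m − shrink D m)
  (env (c ·) m + shrink D m)` (`Siter_subset_pbox_of_near`); the orbit box of one cube has side `≤ width q m` — orbit of
  `0` under `w ↦ ⌈w/q_l⌉ + 20`, `≤ 20m` always, `≤ 40` along an all-gaining stretch (`env_sub_envLo_le_width`,
  `width_le`, `width_le_forty`); hence `|S^{m}(X)| ≤ (width + 2·shrink + 1)^d` (`card_Siter_le_pow`, `card_pbox`) and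
  THE EXCESS CUBE COUNT OF THE MERGE IS BOUNDED PER SCALE: `|S^{m}(X ∪ Y)| ≤ |S^{m}(Y)| + (width + 2·shrink + 1)^d` at
  every `m` (`card_Siter_union_le`; `≤ 43^d` once `shrink ≤ 1` on an all-gaining stretch) — against Part 4's `≥ 1` at
  each of `n + 1` consecutive scales, `n` free: in the model the unpaid overhang of (1.88) is an `O_d(1)`-cube term PER
  SCALE over up to `K₂ − K₁ − n₁` scales (cell `GAPS.md` G-b02g10-1), neither zero (print) nor unbounded per scale.
* Part 5c (v2.1 — UNDER THE DROP CONTROL): along `R = L^σ`, `L ≥ 2`, a step gains iff `σ` does not drop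
  (`two_le_ratio_iff`), so `DropCtl.lag_two` (no two consecutive no-gain steps) gives `⌊m/2⌋ ≤ gains (ratio L σ) m` on
  the horizon (`div_two_le_gains`) and ONE-LAYER ABSORPTION FROM `D ≤ 2^{⌊m/2⌋}` ON, uniformly over all admissible flow
  patterns (`one_layer_absorption_dropCtl`): for the printed `D ≤ 101`, from `m = 14` on — a uniform `n₁`, for ONE layer.
WHAT IS *NOT* CLAIMED.  (a) Nothing about fields, densities, `κ_j`, or the truth of (1.80)/(1.88): the module tests ONE
sentence of the printed ARGUMENT in the cell's declared model of `S`; whether the inductive statement (1.80) admits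
another proof (e.g. an amortised or size-proportional budget — cell `GAPS.md` G-b02g10-1 names the avenues) is not
touched.  (b) No strict inequality for the containment tree size `d′ = TreeLength.treeLen` of the iterates is asserted
(that size is not monotone under inclusion, cell `GAPS.md` G-b02g9-3); the strict defect is proved for the cube count
(Part 4), which bounds `d′` above and below up to the factors of `TreeLength.card_le_treeLen` /
`treeLen_le_card_sub_one`.  (c) The GENERIC behaviour — in random positions absorption holds within a few steps, and
containment up to ONE layer, `S^{m}(X) ⊆ (S^{m}(Y))^{~1}`, already from `m ≤ 2` on — is a numerical observation of the
typist (cell folder `b2b-balaban-b02-g10/numerics/`); the THEOREM (Part 5) gives one layer from `⌈log₂ D⌉` gaining steps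
on (`D` the initial sup-distance), a bound using only `q_l ≥ 2` of the gaining steps; the ladder positions have density
`L^{−n}`.  Whether one layer per merge is affordable in (1.88) — an `O(1)M^dR^{d+1}` per scale over `≤ K₂ − K₁` scales,
i.e. a charge growing with `log d′_{j+1}(Y)` rather than a uniform `O(1)2(100M)^dR^{d+2}_{j+1}` — is the records-level
question of `GAPS.md` G-b02g10-1, not decided here.
(d) The reading of `S` (nested aligned partitions, symmetric layers) is `…B16SProfile`'s, declared there and here, not
adjudicated; under it, the persistence is a property of every operation "cover by the next partition, then add `c`
layers" (`c = 10` here; the ladder with `10 ↦ c` works verbatim).  Value = kernel-checked counterexample family to one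
printed geometric sentence in the cell's model + the located defect it leaves in the (1.88) bookkeeping, NOT summit
progress.
-/

namespace Literature.MathematicalPhysics.QuantumFieldTheory.Balaban1983to89.B16Absorption

open Literature.MathematicalPhysics.QuantumFieldTheory.Balaban1983to89
open Literature.MathematicalPhysics.QuantumFieldTheory.Balaban1983to89.B13ScaleTransfer
open Literature.MathematicalPhysics.QuantumFieldTheory.Balaban1983to89.B16SProfile
open Literature.MathematicalPhysics.QuantumFieldTheory.Balaban1983to89.B16MergeGeometry

noncomputable section

variable {d : ℕ}

/-! ## Part 1. Coordinate envelopes of one `S`-step -/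

/-- The box of radius `0` is the centre cube alone. [folklore] -/
theorem box_zero (c : Pt d) : box c 0 = {c} := by
  ext y
  rw [mem_box, Finset.mem_singleton]
  constructor
  · intro h
    funext i
    obtain ⟨h1, h2⟩ := h i
    push_cast at h1 h2
    omega
  · rintro rfl i
    simp

/-- `n` layers around a single cube lie in the box of radius `n`. [folklore] -/
theorem iterate_collar_singleton_subset_box (c : Pt d) (n : ℕ) : collar^[n] ({c} : Finset (Pt d)) ⊆ box c n := by
  simpa [box_zero] using iterate_collar_box_subset c 0 n

/-- One-dimensional clamping: an index within `n + 1` of `c` is within `1` of an index within `n` of `c`. [folklore] -/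
theorem exists_clamp (c y : ℤ) (n : ℕ) (h1 : c - ((n + 1 : ℕ) : ℤ) ≤ y) (h2 : y ≤ c + ((n + 1 : ℕ) : ℤ)) :
    ∃ t : ℤ, (c - n ≤ t ∧ t ≤ c + n) ∧ (t - 1 ≤ y ∧ y ≤ t + 1) := by
  push_cast at h1 h2
  have hn : (0 : ℤ) ≤ n := by positivity
  by_cases hy : y ≤ c - n
  · exact ⟨c - n, ⟨le_rfl, by linarith⟩, by constructor <;> linarith⟩
  · by_cases hy' : c + n ≤ y
    · exact ⟨c + n, ⟨by linarith, le_rfl⟩, by constructor <;> linarith⟩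
    · have hy₁ : c - n < y := lt_of_not_ge hy
      have hy₂ : y < c + n := lt_of_not_ge hy'
      exact ⟨y, ⟨by linarith, by linarith⟩, by constructor <;> linarith⟩

/-- The box of radius `n + 1` lies within one layer of the box of radius `n`. [folklore] -/
theorem box_succ_subset_collar_box (c : Pt d) (n : ℕ) : box c (n + 1) ⊆ collar (box c n) := by
  intro y hy
  rw [mem_box] at hy
  have key : ∀ i, ∃ t : ℤ, (c i - n ≤ t ∧ t ≤ c i + n) ∧ (t - 1 ≤ y i ∧ y i ≤ t + 1) :=
    fun i => exists_clamp (c i) (y i) n (hy i).1 (hy i).2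
  choose t ht using key
  exact mem_collar.2 ⟨t, mem_box.2 fun i => (ht i).1, mem_block.2 fun i => (ht i).2⟩

/-- `n` LAYERS AROUND A CUBE COVER THE BOX OF RADIUS `n`: `□^{~n} ⊆ collar^[n] {□}` (with
`iterate_collar_singleton_subset_box`, equality). [folklore] -/
theorem box_subset_iterate_collar (c : Pt d) : ∀ n : ℕ, box c n ⊆ collar^[n] ({c} : Finset (Pt d))
  | 0 => by simp [box_zero]
  | n + 1 => by
    rw [Function.iterate_succ_apply']
    exact (box_succ_subset_collar_box c n).trans
      (Finset.biUnion_subset_biUnion_of_subset_left _ (box_subset_iterate_collar c n))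

/-- Every cube of `S_q(T)` lies in the box of radius `10` about the coarse image of a cube of `T`
(`S_q(T) = ⋃_{z ∈ T} collar^[10]{⌊z/q⌋}`). [cite: Balaban1989LargeFieldII, p.384 (definition of S)] -/
theorem exists_box_of_mem_Sop (q : ℕ) {T : Finset (Pt d)} {w : Pt d} (hw : w ∈ Sop q T) :
    ∃ z ∈ T, w ∈ box (coarse q z) 10 := by
  have h : Sop q T = (closureIdx q T).biUnion fun b => collar^[10] ({b} : Finset (Pt d)) := by
    unfold Sop
    conv_lhs => rw [← Finset.biUnion_singleton_eq_self (s := closureIdx q T)]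
    rw [iterate_collar_biUnion]
  rw [h, Finset.mem_biUnion] at hw
  obtain ⟨b, hb, hwb⟩ := hw
  obtain ⟨z, hz, rfl⟩ := Finset.mem_image.1 hb
  exact ⟨z, hz, iterate_collar_singleton_subset_box _ 10 hwb⟩

/-- SUP ENVELOPE OF ONE STEP: if every cube of `T` has `i`-th index `≤ H`, every cube of `S_q(T)` has `i`-th index
`≤ ⌊H/q⌋ + 10` (`q ≥ 1`). [cite: Balaban1989LargeFieldII, p.384 (definition of S)] -/
theorem coord_le_of_mem_Sop {q : ℕ} (hq : 0 < q) {T : Finset (Pt d)} {i : Fin d} {H : ℤ} (hT : ∀ y ∈ T, y i ≤ H)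
    {w : Pt d} (hw : w ∈ Sop q T) : w i ≤ H / (q : ℤ) + 10 := by
  have hq' : (0 : ℤ) < q := by exact_mod_cast hq
  obtain ⟨z, hz, hwz⟩ := exists_box_of_mem_Sop q hw
  rw [mem_box] at hwz
  obtain ⟨-, h2⟩ := hwz i
  have h3 : (coarse q z) i = z i / (q : ℤ) := rfl
  have h4 : z i / (q : ℤ) ≤ H / (q : ℤ) := Int.ediv_le_ediv hq' (hT z hz)
  push_cast at h2
  linarith

/-- ATTAINED VALUE OF ONE STEP: for a cube `z ∈ T`, the cube `⌊z/q⌋ + 10·𝟙` (every index of the coarse image shifted by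
ten layers) belongs to `S_q(T)`. [cite: Balaban1989LargeFieldII, p.384 (definition of S)] -/
theorem shift_coarse_mem_Sop (q : ℕ) {T : Finset (Pt d)} {z : Pt d} (hz : z ∈ T) :
    (fun k => z k / (q : ℤ) + 10) ∈ Sop q T := by
  have hb : coarse q z ∈ closureIdx q T := Finset.mem_image_of_mem _ hz
  have h1 : (fun k => z k / (q : ℤ) + 10) ∈ box (coarse q z) 10 := by
    rw [mem_box]
    intro k
    have : (coarse q z) k = z k / (q : ℤ) := rfl
    rw [this]
    push_cast
    constructor <;> linarith
  have h3 : collar^[10] ({coarse q z} : Finset (Pt d)) ⊆ Sop q T :=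
    iterate_collar_mono 10 (Finset.singleton_subset_iff.2 hb)
  exact h3 (box_subset_iterate_collar _ 10 h1)

/-- The orbit of an index bound under the iterated step `H ↦ ⌊H/q_m⌋ + 10`. [folklore] -/
def env (q : ℕ → ℕ) (H : ℤ) : ℕ → ℤ
  | 0 => H
  | m + 1 => env q H m / (q m : ℤ) + 10

/-- `env` at `0`. [folklore] -/
@[simp] theorem env_zero (q : ℕ → ℕ) (H : ℤ) : env q H 0 = H := rfl

/-- `env` at a successor. [folklore] -/
@[simp] theorem env_succ (q : ℕ → ℕ) (H : ℤ) (m : ℕ) : env q H (m + 1) = env q H m / (q m : ℤ) + 10 := rfl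

/-- SUP ENVELOPE ALONG THE ITERATES: if every cube of `Y` has `i`-th index `≤ H`, every cube of `S^{m}(Y)` has `i`-th
index `≤ env q H m` (positive ratios). [cite: Balaban1989LargeFieldII, p.384 (definition of S)] -/
theorem coord_le_env {q : ℕ → ℕ} (hq : ∀ l, 0 < q l) {Y : Finset (Pt d)} {i : Fin d} {H : ℤ}
    (hY : ∀ y ∈ Y, y i ≤ H) : ∀ (m : ℕ) (w : Pt d), w ∈ Siter q m Y → w i ≤ env q H m
  | 0 => fun w hw => by simpa using hY w hw
  | m + 1 => fun w hw => by
    rw [Siter_succ] at hw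
    rw [env_succ]
    exact coord_le_of_mem_Sop (hq m) (fun y hy => coord_le_env hq hY m y hy) hw

/-- ATTAINED VALUE ALONG THE ITERATES: for `z ∈ T`, some cube of `S^{m}(T)` has `i`-th index exactly `env q (z i) m`. [cite: Balaban1989LargeFieldII, p.384 (definition of S)] -/
theorem exists_mem_Siter_coord_eq (q : ℕ → ℕ) {T : Finset (Pt d)} {z : Pt d} (hz : z ∈ T) (i : Fin d) :
    ∀ m : ℕ, ∃ w ∈ Siter q m T, w i = env q (z i) m
  | 0 => ⟨z, by simpa using hz, rfl⟩
  | m + 1 => by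
    obtain ⟨w, hw, hwi⟩ := exists_mem_Siter_coord_eq q hz i m
    refine ⟨fun k => w k / (q m : ℤ) + 10, ?_, ?_⟩
    · rw [Siter_succ]
      exact shift_coarse_mem_Sop (q m) hw
    · simp [hwi]

/-! ## Part 2. The `L`-adic ladder -/

/-- THE LADDER: `ladder L 0 = 20L`, `ladder L (k+1) = L·(ladder L k − 10)` — the foot is a multiple of `L`, and each
rung is the multiple of `L` whose coarse image, shifted by the ten layers, is the rung below. [folklore] -/
def ladder (L : ℕ) : ℕ → ℤ
  | 0 => 20 * L
  | k + 1 => L * (ladder L k - 10)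

/-- One coarsening of a rung: `⌊ladder(k+1)/L⌋ = ladder k − 10`. [folklore] -/
theorem ladder_succ_ediv {L : ℕ} (hL : 0 < L) (k : ℕ) : ladder L (k + 1) / (L : ℤ) = ladder L k - 10 := by
  have hL' : (L : ℤ) ≠ 0 := by exact_mod_cast hL.ne'
  show (L : ℤ) * (ladder L k - 10) / (L : ℤ) = ladder L k - 10
  exact Int.mul_ediv_cancel_left _ hL'

/-- One coarsening of the index just below a rung: `⌊(ladder(k+1) − 1)/L⌋ = ladder k − 11` (the cube just behind the
wall of an `L`-block goes to the block behind). [folklore] -/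
theorem ladder_succ_sub_one_ediv {L : ℕ} (hL : 0 < L) (k : ℕ) :
    (ladder L (k + 1) - 1) / (L : ℤ) = ladder L k - 11 := by
  have hL' : (0 : ℤ) < L := by exact_mod_cast hL
  show ((L : ℤ) * (ladder L k - 10) - 1) / (L : ℤ) = ladder L k - 11
  have e : (L : ℤ) * (ladder L k - 10) - 1 = (L - 1) + (ladder L k - 11) * L := by ring
  rw [e, Int.add_mul_ediv_right _ _ hL'.ne', Int.ediv_eq_zero_of_lt (by linarith) (by linarith)]
  ring

/-- The foot: `⌊20L/L⌋ = 20`. [folklore] -/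
theorem ladder_zero_ediv {L : ℕ} (hL : 0 < L) : ladder L 0 / (L : ℤ) = 20 := by
  have hL' : (L : ℤ) ≠ 0 := by exact_mod_cast hL.ne'
  show (20 * (L : ℤ)) / (L : ℤ) = 20
  exact Int.mul_ediv_cancel _ hL'

/-- Just below the foot: `⌊(20L − 1)/L⌋ = 19`. [folklore] -/
theorem ladder_zero_sub_one_ediv {L : ℕ} (hL : 0 < L) : (ladder L 0 - 1) / (L : ℤ) = 19 := by
  have hL' : (0 : ℤ) < L := by exact_mod_cast hL
  show (20 * (L : ℤ) - 1) / (L : ℤ) = 19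
  have e : (20 * (L : ℤ) - 1) = (L - 1) + 19 * L := by ring
  rw [e, Int.add_mul_ediv_right _ _ hL'.ne', Int.ediv_eq_zero_of_lt (by linarith) (by linarith)]
  ring

/-- Every rung is at least `20` (`L ≥ 2`) — the ladder climbs; recorded for orientation, not used. [folklore] -/
theorem twenty_le_ladder {L : ℕ} (hL : 2 ≤ L) : ∀ k, (20 : ℤ) ≤ ladder L k
  | 0 => by
    have : (2 : ℤ) ≤ L := by exact_mod_cast hL
    show (20 : ℤ) ≤ 20 * L
    nlinarith
  | k + 1 => by
    have ih := twenty_le_ladder hL k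
    have hL' : (2 : ℤ) ≤ L := by exact_mod_cast hL
    show (20 : ℤ) ≤ L * (ladder L k - 10)
    nlinarith

/-- DOWN THE LADDER, ONE APART: along the constant ratio `L`, the orbits of `u ↦ ⌊u/L⌋ + 10` started at `ladder L n`
and at `ladder L n − 1` are `ladder L (n − m)` and `ladder L (n − m) − 1` after `m ≤ n` steps. [folklore] -/
theorem env_ladder {L : ℕ} (hL : 0 < L) (n : ℕ) : ∀ m, m ≤ n →
    env (fun _ => L) (ladder L n) m = ladder L (n - m) ∧
      env (fun _ => L) (ladder L n - 1) m = ladder L (n - m) - 1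
  | 0, _ => by simp
  | m + 1, hm => by
    obtain ⟨h1, h2⟩ := env_ladder hL n m (Nat.le_of_succ_le hm)
    have hnm : n - m = (n - (m + 1)) + 1 := by omega
    rw [env_succ, env_succ, h1, h2, hnm, ladder_succ_ediv hL, ladder_succ_sub_one_ediv hL]
    constructor <;> ring

/-- … and after `n + 1` steps they are `30` and `29`. [folklore] -/
theorem env_ladder_top {L : ℕ} (hL : 0 < L) (n : ℕ) :
    env (fun _ => L) (ladder L n) (n + 1) = 30 ∧ env (fun _ => L) (ladder L n - 1) (n + 1) = 29 := by
  obtain ⟨h1, h2⟩ := env_ladder hL n n le_rfl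
  rw [env_succ, env_succ, h1, h2, Nat.sub_self, ladder_zero_ediv hL, ladder_zero_sub_one_ediv hL]
  constructor <;> norm_num

/-- THE GAP OF ONE PERSISTS FOR `n + 1` STEPS. [folklore] -/
theorem env_ladder_gap {L : ℕ} (hL : 0 < L) (n : ℕ) {m : ℕ} (hm : m ≤ n + 1) :
    env (fun _ => L) (ladder L n) m = env (fun _ => L) (ladder L n - 1) m + 1 := by
  rcases Nat.lt_or_ge m (n + 1) with h | h
  · obtain ⟨h1, h2⟩ := env_ladder hL n m (Nat.lt_succ_iff.1 h)
    rw [h1, h2]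
    ring
  · obtain rfl : m = n + 1 := le_antisymm hm h
    obtain ⟨h1, h2⟩ := env_ladder_top hL n
    rw [h1, h2]
    norm_num

/-! ## Part 3. Non-absorption persists along the ladder -/

/-- The constant ratio sequence IS a flow pattern of `…B16SProfile`: `ratio L (fun _ => s) = (fun _ => L)`
(`R_n = L^s` for all `n`, every step gains exactly one factor `L`). [cite: Balaban1988Convergent, (2.5) p.255] -/
theorem ratio_const (L s : ℕ) : ratio L (fun _ => s) = fun _ => L := by
  funext i
  simp [ratio, qexp]

/-- … and it obeys the drop control. [cite: Balaban1988Convergent, (2.9) p.256] -/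
theorem dropCtl_const (s m : ℕ) : DropCtl (fun _ => s) m := by
  intro i k _ _
  exact Nat.le_add_right _ _

/-- NON-ABSORPTION PERSISTS (the protruding cube): if `x i = ladder L n` and every cube of `Y` lies in the half-space
`{y | y i ≤ x i − 1}`, then for every `m ≤ n + 1` some cube of `S^{m}({x})` has `i`-th index larger than that of every
cube of `S^{m}(Y)` (constant ratio `L ≥ 1`).  The printed sentence under test: *"It is clear that applying n₁ times the
operation S to the last domain, where n₁ is a rather small number, e.g., n₁ < 10, we obtain the domain S^{K₁+n₁}(Y)
containing S^{K₁+n₁}(X)."* [cite: Balaban1989LargeFieldII, p.387 (lines 12-15)] -/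
theorem exists_protruding {L : ℕ} (hL : 0 < L) (n : ℕ) {i : Fin d} {x : Pt d} (hx : x i = ladder L n)
    {Y : Finset (Pt d)} (hY : ∀ y ∈ Y, y i ≤ x i - 1) {m : ℕ} (hm : m ≤ n + 1) :
    ∃ z ∈ Siter (fun _ => L) m {x}, ∀ w ∈ Siter (fun _ => L) m Y, w i < z i := by
  obtain ⟨z, hz, hzi⟩ := exists_mem_Siter_coord_eq (fun _ => L) (Finset.mem_singleton_self x) i m
  refine ⟨z, hz, fun w hw => ?_⟩
  have hw' : w i ≤ env (fun _ => L) (x i - 1) m := coord_le_env (fun _ => hL) hY m w hw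
  rw [hx] at hw'
  rw [hzi, hx, env_ladder_gap hL n hm]
  linarith

/-- Hence `S^{m}({x}) ⊄ S^{m}(Y)` for every `m ≤ n + 1` — against the printed *"we obtain the domain S^{K₁+n₁}(Y)
containing S^{K₁+n₁}(X)"* read with a uniform `n₁` (take `n := K₁ + n₁`). [cite: Balaban1989LargeFieldII, p.387 (lines 12-15)] -/
theorem not_subset_of_ladder {L : ℕ} (hL : 0 < L) (n : ℕ) {i : Fin d} {x : Pt d} (hx : x i = ladder L n)
    {Y : Finset (Pt d)} (hY : ∀ y ∈ Y, y i ≤ x i - 1) {m : ℕ} (hm : m ≤ n + 1) :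
    ¬ (Siter (fun _ => L) m {x} ⊆ Siter (fun _ => L) m Y) := by
  intro h
  obtain ⟨z, hz, hlt⟩ := exists_protruding hL n hx hY hm
  exact lt_irrefl _ (hlt z (h hz))

/-- Hence `S^{m}({x} ∪ Y) ≠ S^{m}(Y)` for every `m ≤ n + 1` — against the printed *"This implies that
S^{n−j−1}(Z) = S^{n−j−1}(Y) for n ≧ j + 1 + K₁ + n₁"* read with a uniform `n₁`. [cite: Balaban1989LargeFieldII, p.387 (lines 12-15)] -/
theorem Siter_union_ne_of_ladder {L : ℕ} (hL : 0 < L) (n : ℕ) {i : Fin d} {x : Pt d} (hx : x i = ladder L n)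
    {Y : Finset (Pt d)} (hY : ∀ y ∈ Y, y i ≤ x i - 1) {m : ℕ} (hm : m ≤ n + 1) :
    Siter (fun _ => L) m ({x} ∪ Y) ≠ Siter (fun _ => L) m Y := by
  rw [Siter_union]
  intro h
  apply not_subset_of_ladder hL n hx hY hm
  have h' : Siter (fun _ => L) m {x} ⊆ Siter (fun _ => L) m {x} ∪ Siter (fun _ => L) m Y :=
    Finset.subset_union_left
  rwa [h] at h'

/-- Hence the CUBE COUNT of `S^{m}({x} ∪ Y)` strictly exceeds that of `S^{m}(Y)` for every `m ≤ n + 1`. [cite: Balaban1989LargeFieldII, p.387 (lines 12-15)] -/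
theorem card_lt_of_ladder {L : ℕ} (hL : 0 < L) (n : ℕ) {i : Fin d} {x : Pt d} (hx : x i = ladder L n)
    {Y : Finset (Pt d)} (hY : ∀ y ∈ Y, y i ≤ x i - 1) {m : ℕ} (hm : m ≤ n + 1) :
    (Siter (fun _ => L) m Y).card < (Siter (fun _ => L) m ({x} ∪ Y)).card := by
  apply Finset.card_lt_card
  rw [Finset.ssubset_iff_subset_ne]
  refine ⟨?_, fun h => Siter_union_ne_of_ladder hL n hx hY hm h.symm⟩
  rw [Siter_union]
  exact Finset.subset_union_right

/-- The half-space behind the wall is stable under adjoining the wall-neighbour `x − e_i`. [folklore] -/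
theorem halfspace_insert {i : Fin d} {x : Pt d} {W : Finset (Pt d)} (hW : ∀ y ∈ W, y i ≤ x i - 1) :
    ∀ y ∈ insert (Function.update x i (x i - 1)) W, y i ≤ x i - 1 := by
  intro y hy
  rcases Finset.mem_insert.1 hy with rfl | hy
  · simp
  · exact hW y hy

/-- The wall-neighbour `x − e_i` has a common wall with `x` (`B13ScaleTransfer.Adj`), hence TOUCHES it
(`B16MergeGeometry.Touch`: the printed *"intersect, or at least touch each other"*). [cite: Balaban1989LargeFieldII, p.387 (lines 3-6)] -/
theorem touch_wall_neighbour (x : Pt d) (i : Fin d) : Touch x (Function.update x i (x i - 1)) :=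
  Touch.of_adj (adj_update_sub_one x i)

/-- NO UNIFORM ABSORPTION IN THE INDEX MODEL: for every `L ≥ 1`, every direction `i` and every `n₁` there are a ONE-CUBE
domain `X = {x}` and a domain `Y` containing the cube `x − e_i` (common wall with `x`) such that `S^{m}(Y) ⊉ S^{m}(X)`
for ALL `m ≤ n₁ + 1` (constant ratio `L`).  Negation of the uniform reading of *"applying n₁ times the operation S …,
n₁ < 10, we obtain the domain S^{K₁+n₁}(Y) containing S^{K₁+n₁}(X)"*. [cite: Balaban1989LargeFieldII, p.387 (lines 12-15)] -/
theorem no_uniform_absorption (i : Fin d) {L : ℕ} (hL : 0 < L) (n₁ : ℕ) :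
    ∃ x : Pt d, ∃ Y : Finset (Pt d), Function.update x i (x i - 1) ∈ Y ∧ Adj x (Function.update x i (x i - 1)) ∧
      ∀ m ≤ n₁ + 1, ¬ (Siter (fun _ => L) m {x} ⊆ Siter (fun _ => L) m Y) := by
  refine ⟨fun _ => ladder L n₁, {Function.update (fun _ => ladder L n₁) i (ladder L n₁ - 1)},
    Finset.mem_singleton_self _, adj_update_sub_one _ i, fun m hm => ?_⟩
  refine not_subset_of_ladder hL n₁ (i := i) (x := fun _ => ladder L n₁) rfl ?_ hm
  intro y hy
  rw [Finset.mem_singleton] at hy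
  subst hy
  simp

/-! ## Part 4. The cube-count defect in the sum of (1.80) -/

/-- THE DEFECT IN THE CUBE-COUNT CURRENCY: for non-negative weights `w_m` (in (1.80) the weight of the `m`-th iterate is
`O(1)M^dR_n^{d+1}` at the running scale `n = j+1+m`; (1.88) prints `R^{d+1}_{j+1}` throughout, an upper bound since `R_n` is
non-increasing — either is a `w` here) and every horizon `K ≥ n + 1`, the weighted cube counts of the iterates of
`Z = {x} ∪ Y` exceed those of `Y` by at least the total weight of the first `n + 1` scales:
`Σ_{m=1}^{K} w_m|S^{m}Y| + Σ_{m=1}^{n+1} w_m ≤ Σ_{m=1}^{K} w_m|S^{m}({x} ∪ Y)|`.  Feeds the first `≦` of (1.88), which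
replaces the `Z`-terms by the `Y`-terms from the scale `K₁ + n₁` on. [cite: Balaban1989LargeFieldII, (1.88) p.387] -/
theorem sum_card_defect {L : ℕ} (hL : 0 < L) (n : ℕ) {i : Fin d} {x : Pt d} (hx : x i = ladder L n)
    {Y : Finset (Pt d)} (hY : ∀ y ∈ Y, y i ≤ x i - 1) (w : ℕ → ℝ) (hw : ∀ m, 0 ≤ w m) {K : ℕ} (hK : n + 1 ≤ K) :
    (∑ m ∈ Finset.Icc 1 K, w m * ((Siter (fun _ => L) m Y).card : ℝ)) + ∑ m ∈ Finset.Icc 1 (n + 1), w m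
      ≤ ∑ m ∈ Finset.Icc 1 K, w m * ((Siter (fun _ => L) m ({x} ∪ Y)).card : ℝ) := by
  have hsub : Finset.Icc 1 (n + 1) ⊆ Finset.Icc 1 K := Finset.Icc_subset_Icc_right hK
  have eY := Finset.sum_sdiff hsub (f := fun m => w m * ((Siter (fun _ => L) m Y).card : ℝ))
  have eZ := Finset.sum_sdiff hsub (f := fun m => w m * ((Siter (fun _ => L) m ({x} ∪ Y)).card : ℝ))
  rw [← eY, ← eZ]
  have h1 : ∑ m ∈ Finset.Icc 1 K \ Finset.Icc 1 (n + 1), w m * ((Siter (fun _ => L) m Y).card : ℝ)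
      ≤ ∑ m ∈ Finset.Icc 1 K \ Finset.Icc 1 (n + 1), w m * ((Siter (fun _ => L) m ({x} ∪ Y)).card : ℝ) := by
    apply Finset.sum_le_sum
    intro m _
    apply mul_le_mul_of_nonneg_left _ (hw m)
    have : Siter (fun _ => L) m Y ⊆ Siter (fun _ => L) m ({x} ∪ Y) := by
      rw [Siter_union]
      exact Finset.subset_union_right
    exact_mod_cast Finset.card_le_card this
  have h2 : (∑ m ∈ Finset.Icc 1 (n + 1), w m * ((Siter (fun _ => L) m Y).card : ℝ))
      + ∑ m ∈ Finset.Icc 1 (n + 1), w m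
      ≤ ∑ m ∈ Finset.Icc 1 (n + 1), w m * ((Siter (fun _ => L) m ({x} ∪ Y)).card : ℝ) := by
    rw [← Finset.sum_add_distrib]
    apply Finset.sum_le_sum
    intro m hm
    have hm' : m ≤ n + 1 := (Finset.mem_Icc.1 hm).2
    have hlt := card_lt_of_ladder hL n hx hY hm'
    have hle : ((Siter (fun _ => L) m Y).card : ℝ) + 1 ≤ ((Siter (fun _ => L) m ({x} ∪ Y)).card : ℝ) := by
      exact_mod_cast hlt
    nlinarith [hw m]
  linarith

/-! ## Part 5. What survives: ONE-LAYER absorption with a uniform delay (v2, APPEND-ONLY)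

The positive counterpart of Part 3, on the same model and for an ARBITRARY ratio sequence `q_l ≥ 1`: if every cube
of `X` lies within sup-distance `D` of some cube `c ∈ T`, then `S^{m}(X) ⊆ (S^{m}(T))^{~1}` (ONE layer) as soon as the
contracted distance `shrink q D m` (orbit of `D` under `D ↦ ⌈D/q_l⌉`) is `≤ 1` — in particular after any `g` steps with
`q_l ≥ 2` if `D ≤ 2^g` (`one_layer_absorption_of_gains`), e.g. from `m = 7` on along the constant ratio `L ≥ 2` when
`D ≤ 128` (`one_layer_absorption_const`) — the very flow on which CONTAINMENT fails for any prescribed number of steps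
(Part 3).  In the printed situation `D ≤ 101` (*"contained in a cube of the size 100MR"* and touching).  Reader-level
consequence recorded in the cell (`GAPS.md` G-b02g10-1 (3b)): the horizon bound *"K ≦ K₂ + n₁ + R_{j+1}"* survives with
a uniform `n₁`; the cost identity *"S^{n−j−1}(Z) = S^{n−j−1}(Y)"* does not (Parts 3–4). -/

/-- A product box with lower corner `lo` and upper corner `hi`. [folklore] -/
def pbox (lo hi : Pt d) : Finset (Pt d) := Fintype.piFinset fun i => Finset.Icc (lo i) (hi i)

/-- Membership in a product box. [folklore] -/
theorem mem_pbox {lo hi y : Pt d} : y ∈ pbox lo hi ↔ ∀ i, lo i ≤ y i ∧ y i ≤ hi i := by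
  simp [pbox, Fintype.mem_piFinset, Finset.mem_Icc]

/-- The degenerate product box is the single cube. [folklore] -/
theorem pbox_self (z : Pt d) : pbox z z = {z} := by
  ext y
  rw [mem_pbox, Finset.mem_singleton]
  constructor
  · intro h
    funext i
    exact le_antisymm (h i).2 (h i).1
  · rintro rfl i
    exact ⟨le_rfl, le_rfl⟩

/-- Clamping into an interval: an index within `r` of `[lo, hi]` is within `r` of an index of `[lo, hi]`. [folklore] -/
theorem exists_clamp_Icc (lo hi y : ℤ) (r : ℕ) (hlh : lo ≤ hi) (h1 : lo - r ≤ y) (h2 : y ≤ hi + r) :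
    ∃ t : ℤ, (lo ≤ t ∧ t ≤ hi) ∧ (t - r ≤ y ∧ y ≤ t + r) := by
  have hr : (0 : ℤ) ≤ r := by positivity
  by_cases hy : y ≤ lo
  · exact ⟨lo, ⟨le_rfl, hlh⟩, by constructor <;> linarith⟩
  · by_cases hy' : hi ≤ y
    · exact ⟨hi, ⟨hlh, le_rfl⟩, by constructor <;> linarith⟩
    · have hy₁ : lo < y := lt_of_not_ge hy
      have hy₂ : y < hi := lt_of_not_ge hy'
      exact ⟨y, ⟨by linarith, by linarith⟩, by constructor <;> linarith⟩

/-- A product box widened by one layer lies within one layer of the box. [folklore] -/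
theorem pbox_widen_subset_collar {lo hi : Pt d} (hlh : ∀ i, lo i ≤ hi i) :
    pbox (fun i => lo i - 1) (fun i => hi i + 1) ⊆ collar (pbox lo hi) := by
  intro y hy
  rw [mem_pbox] at hy
  have key : ∀ i, ∃ t : ℤ, (lo i ≤ t ∧ t ≤ hi i) ∧ (t - 1 ≤ y i ∧ y i ≤ t + 1) := fun i => by
    obtain ⟨h1, h2⟩ := hy i
    simpa using exists_clamp_Icc (lo i) (hi i) (y i) 1 (hlh i) (by simpa using h1) (by simpa using h2)
  choose t ht using key
  exact mem_collar.2 ⟨t, mem_pbox.2 fun i => (ht i).1, mem_block.2 fun i => (ht i).2⟩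

/-- Surjectivity of coarsening on an interval: every index between `⌊lo/q⌋` and `⌊hi/q⌋` is the coarse image of an index
of `[lo, hi]`. [folklore] -/
theorem exists_preimage_ediv {q : ℕ} (hq : 0 < q) {lo hi t : ℤ} (hlh : lo ≤ hi) (ht1 : lo / (q : ℤ) ≤ t)
    (ht2 : t ≤ hi / (q : ℤ)) : ∃ u : ℤ, lo ≤ u ∧ u ≤ hi ∧ u / (q : ℤ) = t := by
  have hq' : (0 : ℤ) < q := by exact_mod_cast hq
  by_cases h : t = lo / (q : ℤ)
  · exact ⟨lo, le_rfl, hlh, h.symm⟩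
  · have ht1' : lo / (q : ℤ) + 1 ≤ t := by omega
    refine ⟨t * q, ?_, ?_, Int.mul_ediv_cancel _ hq'.ne'⟩
    · have e : (q : ℤ) * (lo / (q : ℤ)) + lo % (q : ℤ) = lo := Int.mul_ediv_add_emod lo q
      have hm := Int.emod_lt_of_pos lo hq'
      have : (q : ℤ) * (lo / (q : ℤ) + 1) ≤ (q : ℤ) * t := mul_le_mul_of_nonneg_left ht1' hq'.le
      linarith
    · have h1 : t * (q : ℤ) ≤ hi / (q : ℤ) * q := mul_le_mul_of_nonneg_right ht2 hq'.le
      have h2 : hi / (q : ℤ) * q ≤ hi := Int.ediv_mul_le hi hq'.ne'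
      linarith

/-- ONE `S`-STEP ON A PRODUCT BOX, from above: `S_q(pbox lo hi) ⊆ pbox (⌊lo/q⌋ − 10) (⌊hi/q⌋ + 10)`. [cite: Balaban1989LargeFieldII, p.384 (definition of S)] -/
theorem Sop_pbox_subset {q : ℕ} (hq : 0 < q) (lo hi : Pt d) :
    Sop q (pbox lo hi) ⊆ pbox (fun i => lo i / (q : ℤ) - 10) (fun i => hi i / (q : ℤ) + 10) := by
  have hq' : (0 : ℤ) < q := by exact_mod_cast hq
  intro w hw
  obtain ⟨z, hz, hwz⟩ := exists_box_of_mem_Sop q hw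
  rw [mem_pbox] at hz
  rw [mem_box] at hwz
  rw [mem_pbox]
  intro i
  obtain ⟨h1, h2⟩ := hwz i
  have h3 : (coarse q z) i = z i / (q : ℤ) := rfl
  rw [h3] at h1 h2
  push_cast at h1 h2
  have h4 : lo i / (q : ℤ) ≤ z i / (q : ℤ) := Int.ediv_le_ediv hq' (hz i).1
  have h5 : z i / (q : ℤ) ≤ hi i / (q : ℤ) := Int.ediv_le_ediv hq' (hz i).2
  constructor <;> linarith

/-- ONE `S`-STEP ON A PRODUCT BOX, from below: if `pbox lo hi ⊆ T` (non-degenerate) then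
`pbox (⌊lo/q⌋ − 10) (⌊hi/q⌋ + 10) ⊆ S_q(T)`. [cite: Balaban1989LargeFieldII, p.384 (definition of S)] -/
theorem pbox_subset_Sop {q : ℕ} (hq : 0 < q) {lo hi : Pt d} {T : Finset (Pt d)} (hT : pbox lo hi ⊆ T)
    (hlh : ∀ i, lo i ≤ hi i) :
    pbox (fun i => lo i / (q : ℤ) - 10) (fun i => hi i / (q : ℤ) + 10) ⊆ Sop q T := by
  have hq' : (0 : ℤ) < q := by exact_mod_cast hq
  intro w hw
  rw [mem_pbox] at hw
  have key : ∀ i, ∃ u : ℤ, (lo i ≤ u ∧ u ≤ hi i) ∧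
      (u / (q : ℤ) - ((10 : ℕ) : ℤ) ≤ w i ∧ w i ≤ u / (q : ℤ) + ((10 : ℕ) : ℤ)) := by
    intro i
    obtain ⟨h1, h2⟩ := hw i
    have hlh' : lo i / (q : ℤ) ≤ hi i / (q : ℤ) := Int.ediv_le_ediv hq' (hlh i)
    obtain ⟨t, ⟨ht1, ht2⟩, ht3, ht4⟩ :=
      exists_clamp_Icc (lo i / (q : ℤ)) (hi i / (q : ℤ)) (w i) 10 hlh' (by simpa using h1) (by simpa using h2)
    obtain ⟨u, hu1, hu2, hu3⟩ := exists_preimage_ediv hq (hlh i) ht1 ht2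
    exact ⟨u, ⟨hu1, hu2⟩, by rw [hu3]; exact ⟨by simpa using ht3, by simpa using ht4⟩⟩
  choose u hu using key
  have huT : u ∈ T := hT (mem_pbox.2 fun i => (hu i).1)
  have hb : coarse q u ∈ closureIdx q T := Finset.mem_image_of_mem _ huT
  have h1 : w ∈ box (coarse q u) 10 := by
    rw [mem_box]
    intro i
    exact (hu i).2
  have h3 : collar^[10] ({coarse q u} : Finset (Pt d)) ⊆ Sop q T :=
    iterate_collar_mono 10 (Finset.singleton_subset_iff.2 hb)
  exact h3 (box_subset_iterate_collar _ 10 h1)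

/-- The orbit of a LOWER index bound under the iterated step `H ↦ ⌊H/q_m⌋ − 10` (companion of `env`). [folklore] -/
def envLo (q : ℕ → ℕ) (H : ℤ) : ℕ → ℤ
  | 0 => H
  | m + 1 => envLo q H m / (q m : ℤ) - 10

/-- `envLo` at `0`. [folklore] -/
@[simp] theorem envLo_zero (q : ℕ → ℕ) (H : ℤ) : envLo q H 0 = H := rfl

/-- `envLo` at a successor. [folklore] -/
@[simp] theorem envLo_succ (q : ℕ → ℕ) (H : ℤ) (m : ℕ) :
    envLo q H (m + 1) = envLo q H m / (q m : ℤ) - 10 := rfl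

/-- The lower orbit stays below the upper orbit. [folklore] -/
theorem envLo_le_env {q : ℕ → ℕ} (hq : ∀ l, 0 < q l) {a b : ℤ} (hab : a ≤ b) :
    ∀ m, envLo q a m ≤ env q b m
  | 0 => by simpa using hab
  | m + 1 => by
    have ih := envLo_le_env hq hab m
    have hq' : (0 : ℤ) < q m := by exact_mod_cast hq m
    rw [envLo_succ, env_succ]
    have := Int.ediv_le_ediv hq' ih
    linarith

/-- THE ITERATES OF ONE CUBE ARE CAUGHT IN THE PRODUCT BOX OF ITS ORBITS:
`S^{m}({z}) ⊆ pbox (envLo (z ·) m) (env (z ·) m)`. [cite: Balaban1989LargeFieldII, p.384 ("S^{n−j}(□) is a cube")] -/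
theorem Siter_singleton_subset_pbox {q : ℕ → ℕ} (hq : ∀ l, 0 < q l) (z : Pt d) :
    ∀ m, Siter q m {z} ⊆ pbox (fun i => envLo q (z i) m) (fun i => env q (z i) m)
  | 0 => by
    rw [Siter_zero, ← pbox_self z]
    rfl
  | m + 1 => by
    rw [Siter_succ]
    refine (Sop_mono (q m) (Siter_singleton_subset_pbox hq z m)).trans ?_
    exact Sop_pbox_subset (hq m) _ _

/-- … AND CONTAIN IT: for `z ∈ T`, `pbox (envLo (z ·) m) (env (z ·) m) ⊆ S^{m}(T)`. [cite: Balaban1989LargeFieldII, p.384 ("S^{n−j}(□) is a cube")] -/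
theorem pbox_orbit_subset_Siter {q : ℕ → ℕ} (hq : ∀ l, 0 < q l) {T : Finset (Pt d)} {z : Pt d} (hz : z ∈ T) :
    ∀ m, pbox (fun i => envLo q (z i) m) (fun i => env q (z i) m) ⊆ Siter q m T
  | 0 => by
    rw [Siter_zero]
    intro y hy
    have : y ∈ pbox z z := hy
    rw [pbox_self, Finset.mem_singleton] at this
    rw [this]
    exact hz
  | m + 1 => by
    rw [Siter_succ]
    exact pbox_subset_Sop (hq m) (pbox_orbit_subset_Siter hq hz m) fun i => envLo_le_env hq le_rfl m

/-- Integer CEILING division by a positive natural: `cdiv D q = ⌈D/q⌉ = −⌊−D/q⌋`. [folklore] -/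
def cdiv (D : ℤ) (q : ℕ) : ℤ := -((-D) / (q : ℤ))

/-- The ceiling property: `D ≤ ⌈D/q⌉·q`. [folklore] -/
theorem le_cdiv_mul (D : ℤ) {q : ℕ} (hq : 0 < q) : D ≤ cdiv D q * q := by
  have hq' : (q : ℤ) ≠ 0 := by exact_mod_cast hq.ne'
  have h := Int.ediv_mul_le (-D) hq'
  unfold cdiv
  linarith

/-- The least such: `D ≤ t·q ⇒ ⌈D/q⌉ ≤ t`. [folklore] -/
theorem cdiv_le_of_le_mul {D t : ℤ} {q : ℕ} (hq : 0 < q) (h : D ≤ t * q) : cdiv D q ≤ t := by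
  have hq' : (0 : ℤ) < q := by exact_mod_cast hq
  have h1 : -t * (q : ℤ) ≤ -D := by linarith
  have h2 : -t * (q : ℤ) / (q : ℤ) ≤ -D / (q : ℤ) := Int.ediv_le_ediv hq' h1
  rw [Int.mul_ediv_cancel _ hq'.ne'] at h2
  unfold cdiv
  linarith

/-- Ceiling division is monotone. [folklore] -/
theorem cdiv_mono {D D' : ℤ} {q : ℕ} (hq : 0 < q) (h : D ≤ D') : cdiv D q ≤ cdiv D' q := by
  have hq' : (0 : ℤ) < q := by exact_mod_cast hq
  have : -D' / (q : ℤ) ≤ -D / (q : ℤ) := Int.ediv_le_ediv hq' (by linarith)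
  unfold cdiv
  linarith

/-- Ceiling division of a non-negative integer is non-negative. [folklore] -/
theorem cdiv_nonneg {D : ℤ} {q : ℕ} (hq : 0 < q) (hD : 0 ≤ D) : 0 ≤ cdiv D q := by
  have hq' : (0 : ℤ) < q := by exact_mod_cast hq
  have : -D / (q : ℤ) ≤ 0 / (q : ℤ) := Int.ediv_le_ediv hq' (by linarith)
  rw [Int.zero_ediv] at this
  unfold cdiv
  linarith

/-- `⌈D/q⌉ ≤ D` for `D ≥ 0`, `q ≥ 1` (no step widens). [folklore] -/
theorem cdiv_le_self {D : ℤ} {q : ℕ} (hq : 0 < q) (hD : 0 ≤ D) : cdiv D q ≤ D :=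
  cdiv_le_of_le_mul hq (le_mul_of_one_le_right hD (by exact_mod_cast hq))

/-- `⌈D/1⌉ = D`. [folklore] -/
theorem cdiv_one (D : ℤ) : cdiv D 1 = D := by
  simp [cdiv]

/-- A gaining step at least halves (rounding up): `q ≥ 2 ⇒ ⌈D/q⌉ ≤ ⌈D/2⌉` (`D ≥ 0`). [folklore] -/
theorem cdiv_le_cdiv_two {D : ℤ} {q : ℕ} (hq : 2 ≤ q) (hD : 0 ≤ D) : cdiv D q ≤ cdiv D 2 := by
  have h0 : 0 ≤ cdiv D 2 := cdiv_nonneg (by norm_num) hD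
  have h1 : D ≤ cdiv D 2 * (2 : ℕ) := le_cdiv_mul D (by norm_num)
  have hq' : ((2 : ℕ) : ℤ) ≤ q := by exact_mod_cast hq
  exact cdiv_le_of_le_mul (by omega) (h1.trans (mul_le_mul_of_nonneg_left hq' h0))

/-- Composition: `⌈⌈D/a⌉/b⌉ ≤ ⌈D/(ab)⌉` (in fact equality). [folklore] -/
theorem cdiv_cdiv_le {D : ℤ} {a b : ℕ} (ha : 0 < a) (hb : 0 < b) : cdiv (cdiv D a) b ≤ cdiv D (a * b) := by
  apply cdiv_le_of_le_mul hb
  apply cdiv_le_of_le_mul ha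
  have h := le_cdiv_mul D (Nat.mul_pos ha hb)
  push_cast at h
  linarith

/-- THE CONTRACTED DISTANCE: orbit of `D` under `D ↦ ⌈D/q_l⌉`. [folklore] -/
def shrink (q : ℕ → ℕ) (D : ℤ) : ℕ → ℤ
  | 0 => D
  | m + 1 => cdiv (shrink q D m) (q m)

/-- `shrink` at `0`. [folklore] -/
@[simp] theorem shrink_zero (q : ℕ → ℕ) (D : ℤ) : shrink q D 0 = D := rfl

/-- `shrink` at a successor. [folklore] -/
@[simp] theorem shrink_succ (q : ℕ → ℕ) (D : ℤ) (m : ℕ) : shrink q D (m + 1) = cdiv (shrink q D m) (q m) := rfl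

/-- CONTRACTION OF THE UPPER ENDS: `a ≤ b + D ⇒ env a m ≤ env b m + shrink D m` (from
`⌊(b + D)/q⌋ ≤ ⌊b/q⌋ + ⌈D/q⌉`). [folklore] -/
theorem env_le_env_add_shrink {q : ℕ → ℕ} (hq : ∀ l, 0 < q l) {a b D : ℤ} (h : a ≤ b + D) :
    ∀ m, env q a m ≤ env q b m + shrink q D m
  | 0 => by simpa using h
  | m + 1 => by
    have ih := env_le_env_add_shrink hq h m
    have hq' : (0 : ℤ) < q m := by exact_mod_cast hq m
    rw [env_succ, env_succ, shrink_succ]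
    set t := cdiv (shrink q D m) (q m) with ht
    have h1 : shrink q D m ≤ t * (q m : ℤ) := le_cdiv_mul _ (hq m)
    have h2 : env q a m ≤ env q b m + t * (q m : ℤ) := by linarith
    have h3 := Int.ediv_le_ediv hq' h2
    rw [Int.add_mul_ediv_right _ _ hq'.ne'] at h3
    linarith

/-- CONTRACTION OF THE LOWER ENDS: `b − D ≤ a ⇒ envLo b m − shrink D m ≤ envLo a m`. [folklore] -/
theorem envLo_sub_shrink_le {q : ℕ → ℕ} (hq : ∀ l, 0 < q l) {a b D : ℤ} (h : b - D ≤ a) :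
    ∀ m, envLo q b m - shrink q D m ≤ envLo q a m
  | 0 => by simpa using h
  | m + 1 => by
    have ih := envLo_sub_shrink_le hq h m
    have hq' : (0 : ℤ) < q m := by exact_mod_cast hq m
    rw [envLo_succ, envLo_succ, shrink_succ]
    set t := cdiv (shrink q D m) (q m) with ht
    have h1 : shrink q D m ≤ t * (q m : ℤ) := le_cdiv_mul _ (hq m)
    have h2 : envLo q b m + (-t) * (q m : ℤ) ≤ envLo q a m := by linarith
    have h3 := Int.ediv_le_ediv hq' h2
    rw [Int.add_mul_ediv_right _ _ hq'.ne'] at h3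
    linarith

/-- ONE-LAYER ABSORPTION (what survives of p. 387 ll. 12–15 in the model, for EVERY ratio sequence `q_l ≥ 1`): if every
cube of `X` lies within sup-distance `D` of a cube `c ∈ T`, then `S^{m}(X) ⊆ (S^{m}(T))^{~1}` as soon as the
contracted distance `shrink q D m` is `≤ 1`.  (The printed *"containing"* — zero layers — fails for any prescribed
number of steps, Part 3; one layer is what the geometry gives.) [cite: Balaban1989LargeFieldII, p.387 (lines 12-15)] -/
theorem one_layer_absorption {q : ℕ → ℕ} (hq : ∀ l, 0 < q l) {X T : Finset (Pt d)} {c : Pt d} (hc : c ∈ T)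
    {D : ℤ} (hX : ∀ x ∈ X, ∀ i, c i - D ≤ x i ∧ x i ≤ c i + D) {m : ℕ} (hs : shrink q D m ≤ 1) :
    Siter q m X ⊆ collar (Siter q m T) := by
  intro w hw
  rw [Siter_eq_biUnion, Finset.mem_biUnion] at hw
  obtain ⟨x, hx, hwx⟩ := hw
  have hb := mem_pbox.1 (Siter_singleton_subset_pbox hq x m hwx)
  have hlh : ∀ i, envLo q (c i) m ≤ env q (c i) m := fun i => envLo_le_env hq le_rfl m
  have hw' : w ∈ pbox (fun i => envLo q (c i) m - 1) (fun i => env q (c i) m + 1) := by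
    rw [mem_pbox]
    intro i
    obtain ⟨h1, h2⟩ := hb i
    have h3 := env_le_env_add_shrink hq (hX x hx i).2 m
    have h4 := envLo_sub_shrink_le hq (hX x hx i).1 m
    constructor <;> linarith
  have h5 := pbox_widen_subset_collar hlh hw'
  exact Finset.biUnion_subset_biUnion_of_subset_left _ (pbox_orbit_subset_Siter hq hc m) h5

/-- THE NUMBER OF GAINING STEPS (`q_l ≥ 2`) among the first `m`. [folklore] -/
def gains (q : ℕ → ℕ) : ℕ → ℕ
  | 0 => 0
  | m + 1 => gains q m + if 2 ≤ q m then 1 else 0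

/-- The contracted distance is non-negative. [folklore] -/
theorem shrink_nonneg {q : ℕ → ℕ} (hq : ∀ l, 0 < q l) {D : ℤ} (hD : 0 ≤ D) : ∀ m, 0 ≤ shrink q D m
  | 0 => by simpa using hD
  | m + 1 => by
    rw [shrink_succ]
    exact cdiv_nonneg (hq m) (shrink_nonneg hq hD m)

/-- `g` GAINING STEPS CONTRACT BY `2^g` (rounding up): `shrink D m ≤ ⌈D/2^{gains m}⌉`. [folklore] -/
theorem shrink_le_cdiv_pow {q : ℕ → ℕ} (hq : ∀ l, 0 < q l) {D : ℤ} (hD : 0 ≤ D) :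
    ∀ m, shrink q D m ≤ cdiv D (2 ^ gains q m)
  | 0 => by simp [gains, cdiv_one]
  | m + 1 => by
    have ih := shrink_le_cdiv_pow hq hD m
    have h0 := shrink_nonneg hq hD m
    rw [shrink_succ]
    show cdiv (shrink q D m) (q m) ≤ cdiv D (2 ^ (gains q m + if 2 ≤ q m then 1 else 0))
    by_cases hg : 2 ≤ q m
    · rw [if_pos hg, pow_succ]
      calc cdiv (shrink q D m) (q m) ≤ cdiv (shrink q D m) 2 := cdiv_le_cdiv_two hg h0
        _ ≤ cdiv (cdiv D (2 ^ gains q m)) 2 := cdiv_mono (by norm_num) ih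
        _ ≤ cdiv D (2 ^ gains q m * 2) := cdiv_cdiv_le (by positivity) (by norm_num)
    · rw [if_neg hg, add_zero]
      exact (cdiv_le_self (hq m) h0).trans ih

/-- Hence `D ≤ 2^{gains m} ⇒ shrink D m ≤ 1`. [folklore] -/
theorem shrink_le_one_of_gains {q : ℕ → ℕ} (hq : ∀ l, 0 < q l) {D : ℤ} (hD : 0 ≤ D) {m : ℕ}
    (hg : D ≤ 2 ^ gains q m) : shrink q D m ≤ 1 := by
  refine (shrink_le_cdiv_pow hq hD m).trans (cdiv_le_of_le_mul (by positivity) ?_)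
  push_cast
  linarith

/-- ONE-LAYER ABSORPTION AFTER `g` GAINING STEPS: `D ≤ 2^{gains q m} ⇒ S^{m}(X) ⊆ (S^{m}(T))^{~1}` — a delay UNIFORM in
`X`, `T`, the position and the scale (for `D ≤ 128`: seven gaining steps). [cite: Balaban1989LargeFieldII, p.387 (lines 12-15)] -/
theorem one_layer_absorption_of_gains {q : ℕ → ℕ} (hq : ∀ l, 0 < q l) {X T : Finset (Pt d)} {c : Pt d}
    (hc : c ∈ T) {D : ℤ} (hD : 0 ≤ D) (hX : ∀ x ∈ X, ∀ i, c i - D ≤ x i ∧ x i ≤ c i + D) {m : ℕ}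
    (hg : D ≤ 2 ^ gains q m) : Siter q m X ⊆ collar (Siter q m T) :=
  one_layer_absorption hq hc hX (shrink_le_one_of_gains hq hD hg)

/-- Along the constant ratio `L ≥ 2` every step gains. [folklore] -/
theorem gains_const {L : ℕ} (hL : 2 ≤ L) : ∀ m, gains (fun _ => L) m = m
  | 0 => rfl
  | m + 1 => by
    show gains (fun _ => L) m + (if 2 ≤ L then 1 else 0) = m + 1
    rw [gains_const hL m, if_pos hL]

/-- ONE-LAYER ABSORPTION ALONG THE CONSTANT RATIO `L ≥ 2` from step `m` on whenever `D ≤ 2^m` — the SAME flow on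
which containment (zero layers) fails for every prescribed number of steps (`no_uniform_absorption`). [cite: Balaban1989LargeFieldII, p.387 (lines 12-15)] -/
theorem one_layer_absorption_const {L : ℕ} (hL : 2 ≤ L) {X T : Finset (Pt d)} {c : Pt d} (hc : c ∈ T)
    {D : ℤ} (hD : 0 ≤ D) (hX : ∀ x ∈ X, ∀ i, c i - D ≤ x i ∧ x i ≤ c i + D) {m : ℕ} (hm : D ≤ 2 ^ m) :
    Siter (fun _ => L) m X ⊆ collar (Siter (fun _ => L) m T) := by
  refine one_layer_absorption_of_gains (fun _ => by omega) hc hD hX ?_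
  rwa [gains_const hL m]

/-! ## Part 5b. Localisation and the per-scale OVERHANG count (v2.1, APPEND-ONLY)

How much of `S^{m}(X ∪ Y)` can stick out of `S^{m}(Y)`: at most the iterates of `X`, which live in the product box of
`c`'s orbits widened by `shrink q D m`, of side `≤ width q m + 2·shrink q D m + 1` per coordinate, where `width` is the
orbit of `0` under `w ↦ ⌈w/q_l⌉ + 20` (`≤ 40` when every step gains, `≤ 20m` always).  So the excess CUBE COUNT of
`Z = X ∪ Y` over `Y` is `≤ (width + 2·shrink + 1)^d` at EVERY scale (`card_Siter_union_le`): bounded per scale —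
`≤ 43^d` once `shrink ≤ 1` along an all-gaining stretch — but, by Part 4, `≥ 1` at each of `n + 1` consecutive scales on
the ladder, `n` free.  (Cell `GAPS.md` G-b02g10-1: the unpaid overhang of (1.88) is an `O_d(1)M^dR^{d+1}` PER SCALE over
up to `K₂ − K₁ − n₁` scales, not a uniform `O(1)2(100M)^dR^{d+2}_{j+1}`.) -/

/-- One coarsening step on a difference: `a ≤ b + W ⇒ ⌊a/q⌋ ≤ ⌊b/q⌋ + ⌈W/q⌉`. [folklore] -/
theorem ediv_le_ediv_add_cdiv {q : ℕ} (hq : 0 < q) {a b W : ℤ} (h : a ≤ b + W) :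
    a / (q : ℤ) ≤ b / (q : ℤ) + cdiv W q := by
  have hq' : (0 : ℤ) < q := by exact_mod_cast hq
  have h1 : W ≤ cdiv W q * (q : ℤ) := le_cdiv_mul _ hq
  have h2 : a ≤ b + cdiv W q * (q : ℤ) := by linarith
  have h3 := Int.ediv_le_ediv hq' h2
  rwa [Int.add_mul_ediv_right _ _ hq'.ne'] at h3

/-- LOCALISATION of the iterates of `X` near the orbit box of `c`:
`S^{m}(X) ⊆ pbox (envLo (c ·) m − shrink D m) (env (c ·) m + shrink D m)`. [cite: Balaban1989LargeFieldII, p.387 (lines 12-15)] -/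
theorem Siter_subset_pbox_of_near {q : ℕ → ℕ} (hq : ∀ l, 0 < q l) {X : Finset (Pt d)} {c : Pt d} {D : ℤ}
    (hX : ∀ x ∈ X, ∀ i, c i - D ≤ x i ∧ x i ≤ c i + D) (m : ℕ) :
    Siter q m X ⊆ pbox (fun i => envLo q (c i) m - shrink q D m) (fun i => env q (c i) m + shrink q D m) := by
  intro w hw
  rw [Siter_eq_biUnion, Finset.mem_biUnion] at hw
  obtain ⟨x, hx, hwx⟩ := hw
  have hb := mem_pbox.1 (Siter_singleton_subset_pbox hq x m hwx)
  rw [mem_pbox]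
  intro i
  obtain ⟨h1, h2⟩ := hb i
  have h3 := env_le_env_add_shrink hq (hX x hx i).2 m
  have h4 := envLo_sub_shrink_le hq (hX x hx i).1 m
  constructor <;> linarith

/-- THE WIDTH of the orbit box of one cube: orbit of `0` under `w ↦ ⌈w/q_l⌉ + 20`. [folklore] -/
def width (q : ℕ → ℕ) : ℕ → ℤ
  | 0 => 0
  | m + 1 => cdiv (width q m) (q m) + 20

/-- `width` at `0`. [folklore] -/
@[simp] theorem width_zero (q : ℕ → ℕ) : width q 0 = 0 := rfl

/-- `width` at a successor. [folklore] -/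
@[simp] theorem width_succ (q : ℕ → ℕ) (m : ℕ) : width q (m + 1) = cdiv (width q m) (q m) + 20 := rfl

/-- The orbit box of one cube has side `≤ width`: `env H m − envLo H m ≤ width q m`. [folklore] -/
theorem env_sub_envLo_le_width {q : ℕ → ℕ} (hq : ∀ l, 0 < q l) (H : ℤ) :
    ∀ m, env q H m - envLo q H m ≤ width q m
  | 0 => by simp
  | m + 1 => by
    have ih := env_sub_envLo_le_width hq H m
    rw [env_succ, envLo_succ, width_succ]
    have h1 : env q H m ≤ envLo q H m + width q m := by linarith
    have h2 := ediv_le_ediv_add_cdiv (hq m) h1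
    linarith

/-- `width` is non-negative. [folklore] -/
theorem width_nonneg {q : ℕ → ℕ} (hq : ∀ l, 0 < q l) : ∀ m, 0 ≤ width q m
  | 0 => le_rfl
  | m + 1 => by
    rw [width_succ]
    have := cdiv_nonneg (hq m) (width_nonneg hq m)
    linarith

/-- Crude bound: `width q m ≤ 20m` (no step widens the coarsened part). [folklore] -/
theorem width_le {q : ℕ → ℕ} (hq : ∀ l, 0 < q l) : ∀ m, width q m ≤ 20 * m
  | 0 => le_rfl
  | m + 1 => by
    rw [width_succ]
    have := cdiv_le_self (hq m) (width_nonneg hq m)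
    have ih := width_le hq m
    push_cast
    linarith

/-- Along an all-gaining stretch the width stays `≤ 40` (fixed point of `w ↦ ⌈w/2⌉ + 20`). [folklore] -/
theorem width_le_forty {q : ℕ → ℕ} (hq2 : ∀ l, 2 ≤ q l) : ∀ m, width q m ≤ 40
  | 0 => by simp
  | m + 1 => by
    have ih := width_le_forty hq2 m
    have h0 : 0 ≤ width q m := width_nonneg (fun l => by have := hq2 l; omega) m
    rw [width_succ]
    have h1 : cdiv (width q m) (q m) ≤ cdiv (width q m) 2 := cdiv_le_cdiv_two (hq2 m) h0
    have h2 : cdiv (width q m) 2 ≤ 20 := cdiv_le_of_le_mul (by norm_num) (by push_cast; linarith)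
    linarith

/-- The cube count of a product box. [folklore] -/
theorem card_pbox (lo hi : Pt d) : (pbox lo hi).card = ∏ i, (hi i + 1 - lo i).toNat := by
  simp [pbox, Fintype.card_piFinset, Int.card_Icc]

/-- THE ITERATES OF `X` HAVE BOUNDED CUBE COUNT: `|S^{m}(X)| ≤ (width q m + 2·shrink q D m + 1)^d`. [cite: Balaban1989LargeFieldII, p.387 (lines 12-15)] -/
theorem card_Siter_le_pow {q : ℕ → ℕ} (hq : ∀ l, 0 < q l) {X : Finset (Pt d)} {c : Pt d} {D : ℤ}
    (hX : ∀ x ∈ X, ∀ i, c i - D ≤ x i ∧ x i ≤ c i + D) (m : ℕ) :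
    (Siter q m X).card ≤ (width q m + 2 * shrink q D m + 1).toNat ^ d := by
  refine (Finset.card_le_card (Siter_subset_pbox_of_near hq hX m)).trans ?_
  rw [card_pbox]
  calc ∏ i, (env q (c i) m + shrink q D m + 1 - (envLo q (c i) m - shrink q D m)).toNat
      ≤ ∏ _i : Fin d, (width q m + 2 * shrink q D m + 1).toNat := by
        refine Finset.prod_le_prod (fun i _ => Nat.zero_le _) fun i _ => Int.toNat_le_toNat ?_
        have := env_sub_envLo_le_width hq (c i) m
        linarith
    _ = (width q m + 2 * shrink q D m + 1).toNat ^ d := by simp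

/-- THE PER-SCALE OVERHANG COUNT of the merge `Z = X ∪ Y`: `|S^{m}(X ∪ Y)| ≤ |S^{m}(Y)| + (width + 2·shrink + 1)^d` at
EVERY scale `m` — an excess bounded per scale (e.g. `≤ 43^d` once `shrink ≤ 1` on an all-gaining stretch), to be set
against Part 4 (excess `≥ 1` at `n + 1` consecutive scales, `n` free). [cite: Balaban1989LargeFieldII, p.387 (lines 12-16)] -/
theorem card_Siter_union_le {q : ℕ → ℕ} (hq : ∀ l, 0 < q l) {X Y : Finset (Pt d)} {c : Pt d} {D : ℤ}
    (hX : ∀ x ∈ X, ∀ i, c i - D ≤ x i ∧ x i ≤ c i + D) (m : ℕ) :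
    (Siter q m (X ∪ Y)).card ≤ (Siter q m Y).card + (width q m + 2 * shrink q D m + 1).toNat ^ d := by
  rw [Siter_union, Finset.union_comm]
  exact (Finset.card_union_le _ _).trans (by simpa using card_Siter_le_pow hq hX m)

/-! ## Part 5c. Under the drop control of the flow: a delay UNIFORM over all admissible flow patterns (v2.1) -/

/-- Along the flow `R = L^σ` (`L ≥ 2`) a step GAINS (`q_i ≥ 2`) iff the size exponent does not drop. [cite: Balaban1988Convergent, (2.5) p.255] -/
theorem two_le_ratio_iff {L : ℕ} (hL : 2 ≤ L) (σ : ℕ → ℕ) (i : ℕ) : 2 ≤ ratio L σ i ↔ σ i ≤ σ (i + 1) := by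
  unfold ratio qexp
  constructor
  · intro h
    by_contra h'
    have e : σ (i + 1) + 1 - σ i = 0 := by omega
    rw [e, pow_zero] at h
    omega
  · intro h
    have e : 1 ≤ σ (i + 1) + 1 - σ i := by omega
    calc 2 ≤ L := hL
      _ = L ^ 1 := (pow_one L).symm
      _ ≤ L ^ (σ (i + 1) + 1 - σ i) := Nat.pow_le_pow_right (by omega) e

/-- UNDER THE DROP CONTROL AT LEAST EVERY OTHER STEP GAINS: `⌊m/2⌋ ≤ gains (ratio L σ) m` on the horizon
(`DropCtl.lag_two`: no two consecutive no-gain steps). [cite: Balaban1989LargeFieldII, p.385 lines 1–3] -/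
theorem div_two_le_gains {L : ℕ} (hL : 2 ≤ L) {σ : ℕ → ℕ} {m' : ℕ} (hσ : DropCtl σ m') :
    ∀ m, m ≤ m' → m / 2 ≤ gains (ratio L σ) m
  | 0, _ => by simp [gains]
  | 1, _ => by simp
  | m + 2, hm => by
    have ih := div_two_le_gains hL hσ m (by omega)
    have h2 := hσ.lag_two (i := m) hm
    have e : (m + 2) / 2 = m / 2 + 1 := by omega
    show (m + 2) / 2 ≤
      gains (ratio L σ) m + (if 2 ≤ ratio L σ m then 1 else 0) + (if 2 ≤ ratio L σ (m + 1) then 1 else 0)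
    by_cases h1 : σ m ≤ σ (m + 1)
    · rw [if_pos ((two_le_ratio_iff hL σ m).2 h1)]
      generalize (if 2 ≤ ratio L σ (m + 1) then 1 else 0) = t
      omega
    · have h3 : σ (m + 1) ≤ σ (m + 2) := by omega
      rw [if_pos ((two_le_ratio_iff hL σ (m + 1)).2 h3)]
      generalize (if 2 ≤ ratio L σ m then 1 else 0) = t
      omega

/-- ONE-LAYER ABSORPTION UNDER THE DROP CONTROL, uniformly over all admissible flow patterns `R = L^σ` (`L ≥ 2`,
`DropCtl σ m'`): on the horizon, `D ≤ 2^{⌊m/2⌋} ⇒ S^{m}(X) ⊆ (S^{m}(T))^{~1}` — for the printed `D ≤ 101 ≤ 2^7`,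
from `m = 14` on. [cite: Balaban1989LargeFieldII, p.387 (lines 12-15)] -/
theorem one_layer_absorption_dropCtl {L : ℕ} (hL : 2 ≤ L) {σ : ℕ → ℕ} {m' : ℕ} (hσ : DropCtl σ m')
    {X T : Finset (Pt d)} {c : Pt d} (hc : c ∈ T) {D : ℤ} (hD : 0 ≤ D)
    (hX : ∀ x ∈ X, ∀ i, c i - D ≤ x i ∧ x i ≤ c i + D) {m : ℕ} (hm : m ≤ m') (hDm : D ≤ 2 ^ (m / 2)) :
    Siter (ratio L σ) m X ⊆ collar (Siter (ratio L σ) m T) := by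
  refine one_layer_absorption_of_gains (fun l => ratio_pos (by omega) σ l) hc hD hX (hDm.trans ?_)
  exact_mod_cast Nat.pow_le_pow_right (by norm_num : 0 < 2) (div_two_le_gains hL hσ m hm)

end

end Literature.MathematicalPhysics.QuantumFieldTheory.Balaban1983to89.B16Absorption
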